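import Summits.ABC.ABC.Theses.DefiniteXi
import Literature.NumberTheory.EllipticCurves.SemistabilityDefect
import Literature.NumberTheory.EllipticCurves.KellerYin2024.PotentiallyGoodOrdinaryPConverse
import HarnessLib

/-!
# `stub_modThree` · ideator k3 · GENERATION 13 — Technique B companion (Φ₂-propagation barrier)

Typed statements (NOT work items; `def … : Prop`, nothing is asserted) behind §2 of
`STUB-IDEAS-stub_modThree-3.md`: along every odd-`p` congruence `E[p] ≅ E'[p]` the semistability
defect at `2` of a potentially good curve with `|Φ₂| ∉ {1,2,p,2p}` is transported (Serre 1972 §5.6: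
`Φ₂ ↪ Aut(E[n])` for `n ≥ 3`; potentially multiplicative inertia is `±`unipotent), so every
odd-congruence partner of a WILD Frey curve (`Φ₂ ∈ {Q₈, SL₂(𝔽₃)}`, S6 + S11 of the skeleton) is
potentially supersingular at `2`: the nearly-ordinary `2`-adic lifting theorem typed in the tree
(`Allen2014_modularity_nearlyOrdinaryDihedral_Q`) can never be reached from the wild core, at any odd
switching prime, through any chain.  The positive helpers G1–G4 / F‴ and the crux-concluding assembly
`FreyModularity_of_stub_modThreeSurj` are in `StubIdeasModThree3G12.lean` (rc 0, 0 sorries,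
re-checked 2026-09-01).  This file: 3 `def`s + one sorry-free corollary.
-/

namespace Summit.ABC.ABC.Cruxes.FreyModularity.StubIdeasModThree3G13

open scoped NumberField
open NumberField IsDedekindDomain
open Literature.NumberTheory.EllipticCurves
open Literature.NumberTheory.Automorphic
open Literature.NumberTheory.Automorphic.BCDT
open Literature.NumberTheory.GaloisRepresentations
open WeierstrassCurve

/-- **P1 — Φ₂-propagation along an odd congruence.**  `W` potentially good at `2` (`j` integral at
`2`) with defect `|Φ₂(W)| ∉ {1, 2, p, 2p}`, `p` an odd prime, `W[p] ≅ W'[p]` (both framed by the same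
`ρ`): then `W'` is potentially good at `2` with the same defect.  (Serre 1972 §5.6 a₃)+b): the inertia
image on `E[p]` is `Φ₂` faithfully when `j` is `2`-integral, and `{±1}·unipotent`, of order
`∈ {1,2,p,2p}`, when it is not.) [cite: Serre1972, §5.6] -/
def SigPhiTwoPropagation : Prop :=
  ∀ (W W' : WeierstrassCurve ℚ) [W.IsElliptic] [W'.IsElliptic] (p : ℕ) [Fact p.Prime]
    (ρ : ModPGaloisRep ℚ (ZMod p) 2), p ≠ 2 →
    W.IsTorsionGaloisRep p ρ → W'.IsTorsionGaloisRep p ρ →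
    0 ≤ padicValRat 2 W.j → W.semistabilityDefectAt 2 ∉ ({1, 2, p, 2 * p} : Set ℕ) →
    0 ≤ padicValRat 2 W'.j ∧ W'.semistabilityDefectAt 2 = W.semistabilityDefectAt 2

/-- **P2 — defect `> 2` at `2` means potentially supersingular** (`Φ₂ ↪ Aut(Ẽ_{𝔽̄₂})`, and
`|Aut| = 2` unless `j̃ = 0`, the supersingular invariant in characteristic `2`), hence NOT potentially
good ordinary at `2` in the tree's sense (`HasPotentiallyGoodOrdinaryReductionAtPrime`).
[cite: Serre1972, §5.6 a)] [cite: SilvermanAEC2009, III.10.1 and V.4] -/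
def SigDefectGtTwoNotOrdinary : Prop :=
  ∀ (W : WeierstrassCurve ℚ) [W.IsElliptic], 0 ≤ padicValRat 2 W.j →
    2 < W.semistabilityDefectAt 2 → ¬ W.HasPotentiallyGoodOrdinaryReductionAtPrime 2

/-- **P3 — the wild Frey core has `Φ₂ ∈ {Q₈, SL₂(𝔽₃)}`.**  On the additive classes
(`A ≡ -1 (mod 4)`, `ord₂ B ∈ {1,2,3}`, `2A + B ≠ 0`): `v₂(j) = 8 - 2·ord₂ B ≥ 2` (potentially good) and
the odd Swan conductor (skeleton S6 `stub_freySwanOdd`) makes inertia act on `E[3]` through a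
non-abelian group (S11 `stub_swanOddNonabelianInertia`), i.e. `Φ₂ ⊆ SL₂(𝔽₃)` non-abelian: order `8`
or `24`. [cite: DiamondKramer1995, Lemma 2 and Lemma 3] [cite: Serre1972, §5.6 a₃)] -/
def SigFreyWildDefect : Prop :=
  ∀ (A B : ℤ) [(freyCurve A B).IsElliptic], IsCoprime A B → A * B * (A + B) ≠ 0 →
    A ≡ -1 [ZMOD 4] → (2 : ℤ) ∣ B → ¬ (16 : ℤ) ∣ B → 2 * A + B ≠ 0 →
    0 ≤ padicValRat 2 (freyCurve A B).j ∧
      ((freyCurve A B).semistabilityDefectAt 2 = 8 ∨ (freyCurve A B).semistabilityDefectAt 2 = 24)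

/-- **The barrier, assembled (sorry-free modulo P1–P3).**  Every curve congruent modulo an odd prime
`p` to a wild Frey curve is potentially good and NOT potentially good ordinary at `2` — so no
`3`–`p` / `p`–`q` switch chain starting on the wild core ever lands on a curve to which a
nearly-ordinary `2`-adic lifting theorem applies. [folklore] -/
theorem freyWild_partner_not_potentiallyGoodOrdinary
    (h1 : SigPhiTwoPropagation) (h2 : SigDefectGtTwoNotOrdinary) (h3 : SigFreyWildDefect)
    (A B : ℤ) [(freyCurve A B).IsElliptic] (hcop : IsCoprime A B) (hne : A * B * (A + B) ≠ 0)
    (hA : A ≡ -1 [ZMOD 4]) (hB : (2 : ℤ) ∣ B) (h16 : ¬ (16 : ℤ) ∣ B) (hc : 2 * A + B ≠ 0)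
    (W' : WeierstrassCurve ℚ) [W'.IsElliptic] (p : ℕ) [Fact p.Prime] (hp : p ≠ 2)
    (ρ : ModPGaloisRep ℚ (ZMod p) 2)
    (hW : (freyCurve A B).IsTorsionGaloisRep p ρ) (hW' : W'.IsTorsionGaloisRep p ρ) :
    0 ≤ padicValRat 2 W'.j ∧ ¬ W'.HasPotentiallyGoodOrdinaryReductionAtPrime 2 := by
  obtain ⟨hj, hdef⟩ := h3 A B hcop hne hA hB h16 hc
  have hprime : p.Prime := Fact.out
  have h2p : ¬ 2 ∣ p := fun hd => by
    rcases hprime.eq_one_or_self_of_dvd 2 hd with h | h <;> omega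
  have hnot : (freyCurve A B).semistabilityDefectAt 2 ∉ ({1, 2, p, 2 * p} : Set ℕ) := by
    intro hmem
    simp only [Set.mem_insert_iff, Set.mem_singleton_iff] at hmem
    rcases hdef with h | h <;> rw [h] at hmem <;> omega
  obtain ⟨hj', hdef'⟩ := h1 (freyCurve A B) W' p ρ hp hW hW' hj hnot
  refine ⟨hj', h2 W' hj' ?_⟩
  rw [hdef']
  rcases hdef with h | h <;> rw [h] <;> norm_num

/-- Same conclusion one congruence further (`W' [q]≅ W''`, `q` odd): the defect is still `8` or `24`,
so the barrier is stable under CHAINS of odd switches (induction step). [folklore] -/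
theorem defect_chain_step (h1 : SigPhiTwoPropagation)
    (W' W'' : WeierstrassCurve ℚ) [W'.IsElliptic] [W''.IsElliptic] (q : ℕ) [Fact q.Prime] (hq : q ≠ 2)
    (ρ : ModPGaloisRep ℚ (ZMod q) 2) (hW' : W'.IsTorsionGaloisRep q ρ) (hW'' : W''.IsTorsionGaloisRep q ρ)
    (hj' : 0 ≤ padicValRat 2 W'.j)
    (hdef' : W'.semistabilityDefectAt 2 = 8 ∨ W'.semistabilityDefectAt 2 = 24) :
    0 ≤ padicValRat 2 W''.j ∧ (W''.semistabilityDefectAt 2 = 8 ∨ W''.semistabilityDefectAt 2 = 24) := by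
  have hprime : q.Prime := Fact.out
  have h2q : ¬ 2 ∣ q := fun hd => by
    rcases hprime.eq_one_or_self_of_dvd 2 hd with h | h <;> omega
  have hnot : W'.semistabilityDefectAt 2 ∉ ({1, 2, q, 2 * q} : Set ℕ) := by
    intro hmem
    simp only [Set.mem_insert_iff, Set.mem_singleton_iff] at hmem
    rcases hdef' with h | h <;> rw [h] at hmem <;> omega
  obtain ⟨hj'', hdef''⟩ := h1 W' W'' q ρ hq hW' hW'' hj' hnot
  exact ⟨hj'', by rw [hdef'']; exact hdef'⟩

end Summit.ABC.ABC.Cruxes.FreyModularity.StubIdeasModThree3G13
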